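import Mathlib
import Summits.NavierStokesRegularity.NavierStokesRegularity.Theorems.RootDecompLitSliceEnergyClockDissipation
import Summits.NavierStokesRegularity.NavierStokesRegularity.Theorems.RootDecompLitSliceMeanFieldBootstrapMap
import HarnessLib

/-!
# Route RootDecompLitSlice — cell Uᶜ `CritTameScarIsCritical` (stmt-NavierStokesRegularity-31733):
# the MEAN-FIELD BOOTSTRAP on Uᶜ's frame — every energy exponent `a < 1/2`, terminal scars of every order
# `α < 1`, energy-Type-(I−ε) at every vertex; Uᶜ reduced to its ENDPOINT modulo the one-step estimate

Helpers toward Uᶜ (`--supports 31733`, no item, no node). The bootstrap map `Ψ(a) = (5+2a)/(4(5−4a))`, its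
fixed-point dynamics, the exponent bookkeeping of the mean-field one-step estimate and the abstract iteration
are the companion module `RootDecompLitSliceMeanFieldBootstrapMap` (see its docstring for the lever). Here:
consequences BY NAME on Uᶜ's frame (maximal smooth solution on `[0,T)`, Leray–Hopf on `[0,T]`, rapidly
decaying datum, TAME at `T`, CRITICAL CLOCK `∫|u(t)−u(T)|² ≤ K√(T−t)`) with ONE inserted antecedent — the
one-step estimate for this solution,
`MeanFieldStep(u,T) : ∀ a ∈ [1/4,1/2), (‖u(t)‖₂² − ‖u(T)‖₂² ≤ C(T−t)^a near T) → (same with Ψ(a))`: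

* `energyLaw_lt_half_of_sqrtClock_of_meanFieldStep` — the energy law at EVERY `a < 1/2` (base `a = 1/4` free by
  `EnergyClockScarLaw.energyLaw_of_clock`, iteration `MeanFieldBootstrap.all_lt_half_of_step`);
* `scar_lt_one_of_sqrtClock_of_meanFieldStep` — terminal scars of EVERY order `α < 1` at every `x₀`
  (`EnergyClockScarLaw.energyClockScarRung` at `b = 1/2`, `α(a) = 1/(3/2 − a) → 1⁻`); Uᶜ is `α = 1`;
* `parabolicDissipation_lt_one_of_meanFieldStep` — the E-letter antecedent of the landed
  `EnergyTypeIVertex.critTameScarIsCritical_of_parabolicDissipation` («energy-Type-I at every vertex») UP TO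
  `ρ^{−ε}`: `∫_{T−ρ²}^T∫_{B_ρ(x₀)}|∇u|²_F ≤ Cρ^γ` for EVERY `γ < 1` (global window dissipation
  `= D(T−ρ²)/(2ν)` by `EnergyClockScarLaw.energyDrop_eq_dissipation_of_tame` dominates the local one);
* cell forms `critTameScar_lt_one_of_meanFieldStep`, `critTameVertex_typeI_eps_of_meanFieldStep` (Uᶜ's frame and
  clock hypothesis VERBATIM + the antecedent); the fixed point `a = 1/2` is Uᶜ's ½-Hölder sub-cell
  `EnergyClockScarLaw.halfHolderClockCell` (landed).

READING. Modulo the one-step estimate, the open content of Uᶜ (the energy strip `a ∈ [1/4, 1/2)` of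
`EnergyClockScarLaw.critTameScarIsCritical_iff_roughCell`) collapses to its ENDPOINT `a = 1/2` / `α = 1` /
`γ = 1`: the bootstrap reaches every sub-endpoint exponent and not the endpoint (constants blow up along the
iteration; by continuity the closing functional is superlinear; Type-I self-similar blow-up sits exactly at the
endpoint). HONEST FRAMING: a conditional face INSIDE the Tao-vacuous, zero-load cell Uᶜ; no item, no node, no
load of any route moves (ROOT ⟺ Uᵃ ∧ P1, critic rows 354/371/698/717). Rung 0: nothing here proves NS
regularity. [folklore]
-/

set_option linter.dupNamespace false

namespace Summit.NavierStokesRegularity.NavierStokesRegularity.Theorems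

open MeasureTheory Set Filter Topology
open scoped ENNReal
open Literature.Analysis.FluidPDE

namespace MeanFieldBootstrap

/-! ### §4 Consequences on Uᶜ's frame, with the one-step estimate as the ONE inserted antecedent -/

/-- ★ **Every sub-endpoint energy exponent.** On the classical Leray–Hopf frame (classical on `[0,T)`,
Leray–Hopf on `[0,T]`, rapidly decaying datum) with the critical clock `∫|u(t)−u(T)|² ≤ K√(T−t)`: the base
exponent `a = 1/4` is free (`EnergyClockScarLaw.energyLaw_of_clock`), so the MEAN-FIELD ONE-STEP
«energy law `a` ⟹ energy law `Ψ(a)` on `[1/4,1/2)`» yields the energy law `‖u(t)‖₂² − ‖u(T)‖₂² ≤ C_a(T−t)^a`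
near `T` for EVERY `a < 1/2`. [folklore] -/
theorem energyLaw_lt_half_of_sqrtClock_of_meanFieldStep
    (ν T : ℝ) (hν : 0 < ν) (hT : 0 < T)
    (u : ℝ → EuclideanSpace ℝ (Fin 3) → EuclideanSpace ℝ (Fin 3)) (p : ℝ → EuclideanSpace ℝ (Fin 3) → ℝ)
    (hcl : IsClassicalNSSolutionOn (Ico 0 T) ν 0 u p) (hLH : IsLerayHopfOn T ν 0 (u 0) u)
    (hdec : HasRapidSpatialDecay (u 0))
    (hclock : ∃ K T₁ : ℝ, T₁ < T ∧ ∀ t ∈ Ioo T₁ T,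
      ∫⁻ x, ‖u t x - u T x‖ₑ ^ 2 ≤ ENNReal.ofReal (K * Real.sqrt (T - t)))
    (hstep : ∀ a : ℝ, 1 / 4 ≤ a → a < 1 / 2 →
      (∃ C T₂ : ℝ, T₂ < T ∧ ∀ t ∈ Ioo T₂ T,
        (∫ x, ‖u t x‖ ^ 2) - ∫ x, ‖u T x‖ ^ 2 ≤ C * (T - t) ^ a) →
      ∃ C T₂ : ℝ, T₂ < T ∧ ∀ t ∈ Ioo T₂ T,
        (∫ x, ‖u t x‖ ^ 2) - ∫ x, ‖u T x‖ ^ 2 ≤ C * (T - t) ^ ((5 + 2 * a) / (4 * (5 - 4 * a)))) :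
    ∀ a : ℝ, a < 1 / 2 → ∃ C T₂ : ℝ, T₂ < T ∧ ∀ t ∈ Ioo T₂ T,
      (∫ x, ‖u t x‖ ^ 2) - ∫ x, ‖u T x‖ ^ 2 ≤ C * (T - t) ^ a := by
  have hclock' : ∃ K T₁ : ℝ, T₁ < T ∧ ∀ t ∈ Ioo T₁ T,
      ∫⁻ x, ‖u t x - u T x‖ₑ ^ 2 ≤ ENNReal.ofReal (K * (T - t) ^ (1 / 2 : ℝ)) := by
    obtain ⟨K, T₁, hT₁, hK⟩ := hclock
    exact ⟨K, T₁, hT₁, fun t ht => by rw [← Real.sqrt_eq_rpow]; exact hK t ht⟩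
  have hbase := EnergyClockScarLaw.energyLaw_of_clock (b := 1 / 2) ν T hν hT u p hcl hLH hdec hclock'
  have h14 : (1 / 2 : ℝ) / 2 = 1 / 4 := by norm_num
  rw [h14] at hbase
  exact all_lt_half_of_step
    (P := fun a => ∃ C T₂ : ℝ, T₂ < T ∧ ∀ t ∈ Ioo T₂ T,
      (∫ x, ‖u t x‖ ^ 2) - ∫ x, ‖u T x‖ ^ 2 ≤ C * (T - t) ^ a)
    hbase hstep (fun a b hab h => powerLaw_mono hab h)

/-- ★ **Terminal scars of EVERY sub-critical order.** Same frame and clock, same inserted antecedent: for every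
`α < 1` and every `x₀`, `∫_{B_r(x₀)}|u(T)|² ≤ C' r^α` for small `r` — the energy–clock scar law
`EnergyClockScarLaw.energyClockScarRung` at `b = 1/2`, `a = 3/2 − 1/max(α, 4/5) < 1/2`, where
`α(a, 1/2) = 1/(3/2 − a) → 1⁻` as `a → 1/2⁻`. (Uᶜ is the order `α = 1`.) [folklore] -/
theorem scar_lt_one_of_sqrtClock_of_meanFieldStep
    (ν T : ℝ) (hν : 0 < ν) (hT : 0 < T)
    (u : ℝ → EuclideanSpace ℝ (Fin 3) → EuclideanSpace ℝ (Fin 3)) (p : ℝ → EuclideanSpace ℝ (Fin 3) → ℝ)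
    (hcl : IsClassicalNSSolutionOn (Ico 0 T) ν 0 u p) (hLH : IsLerayHopfOn T ν 0 (u 0) u)
    (hdec : HasRapidSpatialDecay (u 0))
    (hclock : ∃ K T₁ : ℝ, T₁ < T ∧ ∀ t ∈ Ioo T₁ T,
      ∫⁻ x, ‖u t x - u T x‖ₑ ^ 2 ≤ ENNReal.ofReal (K * Real.sqrt (T - t)))
    (hstep : ∀ a : ℝ, 1 / 4 ≤ a → a < 1 / 2 →
      (∃ C T₂ : ℝ, T₂ < T ∧ ∀ t ∈ Ioo T₂ T,
        (∫ x, ‖u t x‖ ^ 2) - ∫ x, ‖u T x‖ ^ 2 ≤ C * (T - t) ^ a) →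
      ∃ C T₂ : ℝ, T₂ < T ∧ ∀ t ∈ Ioo T₂ T,
        (∫ x, ‖u t x‖ ^ 2) - ∫ x, ‖u T x‖ ^ 2 ≤ C * (T - t) ^ ((5 + 2 * a) / (4 * (5 - 4 * a)))) :
    ∀ α : ℝ, α < 1 → ∀ x₀ : EuclideanSpace ℝ (Fin 3), ∃ C' r₁ : ℝ, 0 < r₁ ∧ ∀ r ∈ Ioo 0 r₁,
      ∫ x in Metric.ball x₀ r, ‖u T x‖ ^ 2 ≤ C' * r ^ α := by
  intro α hα x₀
  obtain ⟨α', hα'def⟩ : ∃ α' : ℝ, α' = max α (4 / 5) := ⟨_, rfl⟩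
  have hα'1 : α' < 1 := by rw [hα'def]; exact max_lt hα (by norm_num)
  have hα'0 : 4 / 5 ≤ α' := by rw [hα'def]; exact le_max_right _ _
  have hαα' : α ≤ α' := by rw [hα'def]; exact le_max_left _ _
  have hα'pos : 0 < α' := by linarith
  obtain ⟨a, hadef⟩ : ∃ a : ℝ, a = 3 / 2 - 1 / α' := ⟨_, rfl⟩
  have hinv1 : 1 < 1 / α' := by rw [lt_div_iff₀ hα'pos]; linarith
  have hinv2 : 1 / α' ≤ 5 / 4 := by rw [div_le_iff₀ hα'pos]; linarith
  have ha_lt : a < 1 / 2 := by rw [hadef]; linarith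
  have ha_ge : 1 / 4 ≤ a := by rw [hadef]; linarith
  have henergy := energyLaw_lt_half_of_sqrtClock_of_meanFieldStep ν T hν hT u p hcl hLH hdec hclock
    hstep a ha_lt
  have hclock' : ∃ K T₁ : ℝ, T₁ < T ∧ ∀ t ∈ Ioo T₁ T,
      ∫⁻ x, ‖u t x - u T x‖ₑ ^ 2 ≤ ENNReal.ofReal (K * (T - t) ^ (1 / 2 : ℝ)) := by
    obtain ⟨K, T₁, hT₁, hK⟩ := hclock
    exact ⟨K, T₁, hT₁, fun t ht => by rw [← Real.sqrt_eq_rpow]; exact hK t ht⟩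
  obtain ⟨C', r₁, hr₁, hC'⟩ := EnergyClockScarLaw.energyClockScarRung (a := a) (b := 1 / 2)
    (by norm_num) (by linarith) (by linarith) ν T hν hT u p hcl hLH hdec hclock' henergy x₀
  have hgap : 1 + 1 / 2 - a = 1 / α' := by rw [hadef]; ring
  have hexp : 2 * (1 / 2 : ℝ) / (1 + 1 / 2 - a) = α' := by
    rw [hgap]; field_simp
  refine ⟨max C' 0, min r₁ 1, lt_min hr₁ one_pos, fun r hr => ?_⟩
  have hr0 : 0 < r := hr.1
  have hrr₁ : r < r₁ := lt_of_lt_of_le hr.2 (min_le_left _ _)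
  have hr1 : r ≤ 1 := (lt_of_lt_of_le hr.2 (min_le_right _ _)).le
  have h1 := hC' r ⟨hr0, hrr₁⟩
  rw [hexp] at h1
  have hpow : r ^ α' ≤ r ^ α := Real.rpow_le_rpow_of_exponent_ge hr0 hr1 hαα'
  calc ∫ x in Metric.ball x₀ r, ‖u T x‖ ^ 2 ≤ C' * r ^ α' := h1
    _ ≤ max C' 0 * r ^ α' := mul_le_mul_of_nonneg_right (le_max_left _ _) (Real.rpow_nonneg hr0.le _)
    _ ≤ max C' 0 * r ^ α := mul_le_mul_of_nonneg_left hpow (le_max_right _ _)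

/-- ★ **Energy-Type-(I−ε) at every vertex** (the E-letter of the landed
`EnergyTypeIVertex.critTameScarIsCritical_of_parabolicDissipation`, up to `ρ^{−ε}`). On Uᶜ's frame
(maximal smooth solution, Leray–Hopf, decaying datum, TAME at `T`) with the critical clock and the one-step
antecedent: for every `γ < 1` and every `x₀`, `∫_{T−ρ²}^T ∫_{B_ρ(x₀)} |∇u|²_F ≤ C ρ^γ` for small `ρ` — the
global window dissipation `= D(T−ρ²)/(2ν) ≤ C ρ^{2a}/(2ν)` (`energyDrop_eq_dissipation_of_tame`, `2a = γ`)
dominates the parabolic-local one. The landed E-letter antecedent is the endpoint `γ = 1`. [folklore] -/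
theorem parabolicDissipation_lt_one_of_meanFieldStep
    (ν T : ℝ) (hν : 0 < ν) (hT : 0 < T)
    (u : ℝ → EuclideanSpace ℝ (Fin 3) → EuclideanSpace ℝ (Fin 3)) (p : ℝ → EuclideanSpace ℝ (Fin 3) → ℝ)
    (hmax : IsMaximalSmoothSolution ν 0 u p T) (hLH : IsLerayHopfOn T ν 0 (u 0) u)
    (hdec : HasRapidSpatialDecay (u 0))
    (htame : Tendsto (fun t => eLpNorm (u t - u T) 2 volume) (𝓝[<] T) (𝓝 0))
    (hclock : ∃ K T₁ : ℝ, T₁ < T ∧ ∀ t ∈ Ioo T₁ T,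
      ∫⁻ x, ‖u t x - u T x‖ₑ ^ 2 ≤ ENNReal.ofReal (K * Real.sqrt (T - t)))
    (hstep : ∀ a : ℝ, 1 / 4 ≤ a → a < 1 / 2 →
      (∃ C T₂ : ℝ, T₂ < T ∧ ∀ t ∈ Ioo T₂ T,
        (∫ x, ‖u t x‖ ^ 2) - ∫ x, ‖u T x‖ ^ 2 ≤ C * (T - t) ^ a) →
      ∃ C T₂ : ℝ, T₂ < T ∧ ∀ t ∈ Ioo T₂ T,
        (∫ x, ‖u t x‖ ^ 2) - ∫ x, ‖u T x‖ ^ 2 ≤ C * (T - t) ^ ((5 + 2 * a) / (4 * (5 - 4 * a)))) :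
    ∀ γ : ℝ, γ < 1 → ∀ x₀ : EuclideanSpace ℝ (Fin 3), ∃ C ρ₁ : ℝ, 0 < ρ₁ ∧ ∀ ρ ∈ Ioo 0 ρ₁,
      ∫⁻ t in Ioo (T - ρ ^ 2) T, ∫⁻ x in Metric.ball x₀ ρ,
        ENNReal.ofReal (frobeniusNormSq (fderiv ℝ (u t) x)) ≤ ENNReal.ofReal (C * ρ ^ γ) := by
  intro γ hγ x₀
  obtain ⟨C, T₂, hT₂, hC⟩ := energyLaw_lt_half_of_sqrtClock_of_meanFieldStep ν T hν hT u p hmax.1 hLH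
    hdec hclock hstep (γ / 2) (by linarith)
  obtain ⟨T₃, hT₃def⟩ : ∃ T₃ : ℝ, T₃ = max T₂ 0 := ⟨_, rfl⟩
  have hT₃T : T₃ < T := by rw [hT₃def]; exact max_lt hT₂ hT
  have hT₂₃ : T₂ ≤ T₃ := by rw [hT₃def]; exact le_max_left _ _
  have hT₃0 : 0 ≤ T₃ := by rw [hT₃def]; exact le_max_right _ _
  have h2ν : 0 < 2 * ν := by positivity
  refine ⟨max C 0 / (2 * ν), Real.sqrt (T - T₃), Real.sqrt_pos.2 (by linarith), fun ρ hρ => ?_⟩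
  have hρ0 : 0 < ρ := hρ.1
  have hρ2 : ρ ^ 2 < T - T₃ := (Real.lt_sqrt hρ0.le).1 hρ.2
  have hρsq : 0 < ρ ^ 2 := by positivity
  -- the window `t = T − ρ²`
  have ht0 : 0 ≤ T - ρ ^ 2 := by linarith
  have htT : T - ρ ^ 2 < T := by linarith
  have hT₂t : T₂ < T - ρ ^ 2 := by linarith
  have hfin := (CertifiedBlowupAxisymBlowup.EnergyDrain.dissipation_le_energy_sub hν hmax.1 hLH ht0
    htT.le le_rfl).1
  have hid := EnergyClockScarLaw.energyDrop_eq_dissipation_of_tame hν hT hmax.1 hLH htame ⟨ht0, htT⟩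
  have hD := hC (T - ρ ^ 2) ⟨hT₂t, htT⟩
  have hTt : T - (T - ρ ^ 2) = ρ ^ 2 := by ring
  have hpow : (T - (T - ρ ^ 2)) ^ (γ / 2) = ρ ^ γ := by
    rw [hTt, show (ρ ^ 2 : ℝ) = ρ ^ (2 : ℝ) by rw [← Real.rpow_natCast ρ 2]; norm_num,
      ← Real.rpow_mul hρ0.le]
    congr 1
    ring
  rw [hpow] at hD
  -- global window dissipation in real currency
  have hglob : (∫⁻ τ in Ioo (T - ρ ^ 2) T, ∫⁻ x,
      ENNReal.ofReal (frobeniusNormSq (fderiv ℝ (u τ) x))).toReal ≤ max C 0 / (2 * ν) * ρ ^ γ := by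
    have hργ : 0 ≤ ρ ^ γ := Real.rpow_nonneg hρ0.le _
    have h1 : 2 * ν * (∫⁻ τ in Ioo (T - ρ ^ 2) T, ∫⁻ x,
        ENNReal.ofReal (frobeniusNormSq (fderiv ℝ (u τ) x))).toReal ≤ max C 0 * ρ ^ γ := by
      rw [← hid]
      exact hD.trans (mul_le_mul_of_nonneg_right (le_max_left _ _) hργ)
    rw [div_mul_eq_mul_div, le_div_iff₀ h2ν]
    linarith
  -- parabolic-local ≤ global
  calc ∫⁻ τ in Ioo (T - ρ ^ 2) T, ∫⁻ x in Metric.ball x₀ ρ,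
        ENNReal.ofReal (frobeniusNormSq (fderiv ℝ (u τ) x))
      ≤ ∫⁻ τ in Ioo (T - ρ ^ 2) T, ∫⁻ x, ENNReal.ofReal (frobeniusNormSq (fderiv ℝ (u τ) x)) :=
        lintegral_mono fun τ => setLIntegral_le_lintegral _ _
    _ = ENNReal.ofReal ((∫⁻ τ in Ioo (T - ρ ^ 2) T, ∫⁻ x,
          ENNReal.ofReal (frobeniusNormSq (fderiv ℝ (u τ) x))).toReal) := (ENNReal.ofReal_toReal hfin).symm
    _ ≤ ENNReal.ofReal (max C 0 / (2 * ν) * ρ ^ γ) := ENNReal.ofReal_le_ofReal hglob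

/-- **Cell form, scars**: Uᶜ `CritTameScarIsCritical`'s frame (maximal smooth solution, Leray–Hopf, decaying
datum, tame at `T`) and its √-clock hypothesis VERBATIM, with ONE inserted antecedent — the mean-field one-step
estimate — and the conclusion at EVERY sub-critical order `α < 1` (Uᶜ's conclusion is the order `α = 1`).
[folklore] -/
theorem critTameScar_lt_one_of_meanFieldStep :
    ∀ (ν T : ℝ), 0 < ν → 0 < T → ∀ (u : ℝ → EuclideanSpace ℝ (Fin 3) → EuclideanSpace ℝ (Fin 3))
      (p : ℝ → EuclideanSpace ℝ (Fin 3) → ℝ),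
      Literature.Analysis.FluidPDE.IsMaximalSmoothSolution ν 0 u p T →
      Literature.Analysis.FluidPDE.IsLerayHopfOn T ν 0 (u 0) u →
      Literature.Analysis.FluidPDE.HasRapidSpatialDecay (u 0) →
      Filter.Tendsto (fun t => MeasureTheory.eLpNorm (u t - u T) 2 MeasureTheory.volume)
        (nhdsWithin T (Set.Iio T)) (nhds 0) →
      (∃ K T₁ : ℝ, T₁ < T ∧ ∀ t ∈ Set.Ioo T₁ T,
        ∫⁻ x, ‖u t x - u T x‖ₑ ^ 2 ≤ ENNReal.ofReal (K * Real.sqrt (T - t))) →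
      (∀ a : ℝ, 1 / 4 ≤ a → a < 1 / 2 →
        (∃ C T₂ : ℝ, T₂ < T ∧ ∀ t ∈ Set.Ioo T₂ T,
          (∫ x, ‖u t x‖ ^ 2) - ∫ x, ‖u T x‖ ^ 2 ≤ C * (T - t) ^ a) →
        ∃ C T₂ : ℝ, T₂ < T ∧ ∀ t ∈ Set.Ioo T₂ T,
          (∫ x, ‖u t x‖ ^ 2) - ∫ x, ‖u T x‖ ^ 2 ≤ C * (T - t) ^ ((5 + 2 * a) / (4 * (5 - 4 * a)))) →
      ∀ α : ℝ, α < 1 → ∀ x₀ : EuclideanSpace ℝ (Fin 3), ∃ C' r₁ : ℝ, 0 < r₁ ∧ ∀ r ∈ Set.Ioo 0 r₁,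
        ∫ x in Metric.ball x₀ r, ‖u T x‖ ^ 2 ≤ C' * r ^ α :=
  fun ν T hν hT u p hmax hLH hdec _htame hclock hstep =>
    scar_lt_one_of_sqrtClock_of_meanFieldStep ν T hν hT u p hmax.1 hLH hdec hclock hstep

/-- **Cell form, vertices**: Uᶜ's frame and √-clock hypothesis VERBATIM, the one-step antecedent inserted, and
the conclusion «every vertex is energy-Type-(I−ε)»: the parabolic-local dissipation antecedent of
`EnergyTypeIVertex.critTameScarIsCritical_of_parabolicDissipation` with `ρ^γ`, EVERY `γ < 1`, in place of `ρ`.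
[folklore] -/
theorem critTameVertex_typeI_eps_of_meanFieldStep :
    ∀ (ν T : ℝ), 0 < ν → 0 < T → ∀ (u : ℝ → EuclideanSpace ℝ (Fin 3) → EuclideanSpace ℝ (Fin 3))
      (p : ℝ → EuclideanSpace ℝ (Fin 3) → ℝ),
      Literature.Analysis.FluidPDE.IsMaximalSmoothSolution ν 0 u p T →
      Literature.Analysis.FluidPDE.IsLerayHopfOn T ν 0 (u 0) u →
      Literature.Analysis.FluidPDE.HasRapidSpatialDecay (u 0) →
      Filter.Tendsto (fun t => MeasureTheory.eLpNorm (u t - u T) 2 MeasureTheory.volume)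
        (nhdsWithin T (Set.Iio T)) (nhds 0) →
      (∃ K T₁ : ℝ, T₁ < T ∧ ∀ t ∈ Set.Ioo T₁ T,
        ∫⁻ x, ‖u t x - u T x‖ₑ ^ 2 ≤ ENNReal.ofReal (K * Real.sqrt (T - t))) →
      (∀ a : ℝ, 1 / 4 ≤ a → a < 1 / 2 →
        (∃ C T₂ : ℝ, T₂ < T ∧ ∀ t ∈ Set.Ioo T₂ T,
          (∫ x, ‖u t x‖ ^ 2) - ∫ x, ‖u T x‖ ^ 2 ≤ C * (T - t) ^ a) →
        ∃ C T₂ : ℝ, T₂ < T ∧ ∀ t ∈ Set.Ioo T₂ T,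
          (∫ x, ‖u t x‖ ^ 2) - ∫ x, ‖u T x‖ ^ 2 ≤ C * (T - t) ^ ((5 + 2 * a) / (4 * (5 - 4 * a)))) →
      ∀ γ : ℝ, γ < 1 → ∀ x₀ : EuclideanSpace ℝ (Fin 3), ∃ C ρ₁ : ℝ, 0 < ρ₁ ∧ ∀ ρ ∈ Set.Ioo 0 ρ₁,
        ∫⁻ t in Set.Ioo (T - ρ ^ 2) T, ∫⁻ x in Metric.ball x₀ ρ,
          ENNReal.ofReal (frobeniusNormSq (fderiv ℝ (u t) x)) ≤ ENNReal.ofReal (C * ρ ^ γ) :=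
  fun ν T hν hT u p hmax hLH hdec htame hclock hstep =>
    parabolicDissipation_lt_one_of_meanFieldStep ν T hν hT u p hmax hLH hdec htame hclock hstep

end MeanFieldBootstrap

end Summit.NavierStokesRegularity.NavierStokesRegularity.Theorems
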